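import Mathlib
import Summits.Ventures.PercRepro2.MixChordORootEdgeClosure
import Summits.Ventures.PercRepro2.MixChordOLeafRootMirror

/-!
# The root-edge closure of the `o`-class `D`-chord at the OTHER root, modulo `(S)`
(blind cell PercRepro2, night-1 g22; proofs/NIGHT1-G22.md §6)

MixChordORootEdgeClosure.lean closes the `D`-chord along `f = {o, a₁}` under adding an edge
`e = {a₁, a₃}` at the root OF the `o`-edge, modulo `(S)`.  The Bernstein identity is symmetric in the
roots (`Gc_swap`, `PDEvent_root_swap`, `avoidAll_root_swap`), so for an edge `e = {a₂, a₃}` at the OTHER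
root the same identity holds with the roots swapped, and its `t²` coefficient is now the chord of
`g₁ = J(p[e ↦ 1])` along `{o, a₁}` — the `J`-chord of MixChordOChords.lean (**`g1_chord'`**).  Hence
**`dChord_of_update_zero_of_S'`**: `0 ≤ S'` (the root-swapped `SClosure`) and the `D`-chord at
`p[e ↦ 0]` give the `D`-chord at `p`, for `e = {a₂, a₃}`.  Own code; standard axioms.
-/

namespace Summit.Ventures.PercRepro2

open UnionCluster CovForm

namespace Mix

section Mirror

variable {V : Type*} {E : Type*} [Fintype E] [DecidableEq E] [Fintype V] [DecidableEq V]
  {R : Type*} [Field R] [LinearOrder R] [IsStrictOrderedRing R]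

variable (p : E → R) (ends : E → Sym2 V) {o a₁ a₂ a₃ : V} (b : V) {e f : E}

/-- **The `g₁`-chord at the other root**: with the roots swapped, `g₁ = J(p[e ↦ 1])`, and its chord along
`f = {o, a₁}` is the `J`-chord. -/
lemma g1_chord' (hp : IsProbVec p) (hf : ends f = s(o, a₁)) (hef : e ≠ f) :
    (1 - p f) * g1C (Function.update p f 0) ends o a₂ a₁ b e ≤ g1C p ends o a₂ a₁ b e := by
  have hp1 : IsProbVec (Function.update p e 1) := hp.update e zero_le_one le_rfl
  have h := jChord (Function.update p e 1) ends (a₂ := a₂) b hp1 hf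
  rw [Function.update_of_ne hef.symm, Function.update_comm hef] at h
  rw [g1C_eq, g1C_eq]
  simp only [covC_root_swap (Function.update p e 1) ends a₁ a₂,
    covC_root_swap (Function.update (Function.update p f 0) e 1) ends a₁ a₂]
  exact h

/-- **The root-edge closure at the other root, modulo `(S)`**: for `e = {a₂, a₃}` and `f = {o, a₁}`. -/
theorem dChord_of_update_zero_of_S' (hp : IsProbVec p) (hends : ends e = s(a₂, a₃))
    (hf : ends f = s(o, a₁)) (hef : e ≠ f)
    (hM : 0 < prob (Function.update p e 0) (avoidAll ends a₂ {a₁}) *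
      prob (Function.update p e 1) (avoidAll ends a₂ {a₁}) *
      prob (Function.update (Function.update p f 0) e 0) (avoidAll ends a₂ {a₁}) *
      prob (Function.update (Function.update p f 0) e 1) (avoidAll ends a₂ {a₁}))
    (hS : 0 ≤ SClosure p ends o a₂ a₁ a₃ b e f)
    (h0 : NMixChord (normD ends a₁ a₂ a₃) (Function.update p e 0) ends o a₁ a₂ a₃ b f) :
    NMixChord (normD ends a₁ a₂ a₃) p ends o a₁ a₂ a₃ b f := by
  have hp0 : IsProbVec (Function.update p e 0) := hp.update e le_rfl zero_le_one
  have hpf : IsProbVec (Function.update p f 0) := hp.update f le_rfl zero_le_one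
  have hp0f : IsProbVec (Function.update (Function.update p f 0) e 0) := hpf.update e le_rfl zero_le_one
  have hG1 : Gc (Function.update p f 1) ends o a₂ a₁ a₃ b = 0 := by
    rw [Gc_swap]
    exact Gc_eq_zero_of_sure_conn_o _ ends o a₃ b (conn_a1_o_of_update_one p ends hf)
  have hG1' : Gc (Function.update (Function.update p e 0) f 1) ends o a₂ a₁ a₃ b = 0 := by
    rw [Gc_swap]
    exact Gc_eq_zero_of_sure_conn_o _ ends o a₃ b (conn_a1_o_of_update_one (Function.update p e 0) ends hf)
  rw [← nMixChord_normD_root_swap] at h0 ⊢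
  unfold NMixChord normD at h0 ⊢
  rw [hG1', mul_zero, sub_zero, Function.update_of_ne hef.symm, Function.update_comm hef] at h0
  rw [hG1, mul_zero, sub_zero]
  rw [avoidAll_root_swap] at hM
  have hΔ₀ : 0 ≤ Gc (Function.update p e 0) ends o a₂ a₁ a₃ b *
      prob (Function.update (Function.update p f 0) e 0) (PDEvent ends a₂ a₁ a₃) -
      (1 - p f) * Gc (Function.update (Function.update p f 0) e 0) ends o a₂ a₁ a₃ b *
        prob (Function.update p e 0) (PDEvent ends a₂ a₁ a₃) := by linarith
  have hg := g1_chord' p ends (a₂ := a₂) b hp hf hef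
  have ht0 := hp.nonneg e
  have ht1 := hp.le_one e
  have h1t : 0 ≤ 1 - p e := sub_nonneg.2 ht1
  have hD0 := prob_nonneg hp0 (PDEvent ends a₂ a₁ a₃)
  have hD0f := prob_nonneg hp0f (PDEvent ends a₂ a₁ a₃)
  have hQ0 := prob_nonneg hp0 (avoidAll ends a₁ {a₂})
  have hQ1 := prob_nonneg (hp.update e zero_le_one le_rfl) (avoidAll ends a₁ {a₂})
  have hQ1f := prob_nonneg (hpf.update e zero_le_one le_rfl) (avoidAll ends a₁ {a₂})
  have hid := closure_identity p ends b (o := o) (a₁ := a₂) (a₂ := a₁) (a₃ := a₃) hends hef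
  have hbr : 0 ≤ (1 - p e) ^ 2 *
      ((1 - p e) ^ 2 *
          (prob (Function.update p e 0) (avoidAll ends a₁ {a₂}) * prob (Function.update p e 1) (avoidAll ends a₁ {a₂}) *
            prob (Function.update (Function.update p f 0) e 0) (avoidAll ends a₁ {a₂}) *
            prob (Function.update (Function.update p f 0) e 1) (avoidAll ends a₁ {a₂})) *
          (Gc (Function.update p e 0) ends o a₂ a₁ a₃ b *
              prob (Function.update (Function.update p f 0) e 0) (PDEvent ends a₂ a₁ a₃) -
            (1 - p f) * Gc (Function.update (Function.update p f 0) e 0) ends o a₂ a₁ a₃ b *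
              prob (Function.update p e 0) (PDEvent ends a₂ a₁ a₃)) +
        p e * (1 - p e) *
          (prob (Function.update p e 0) (avoidAll ends a₁ {a₂}) * prob (Function.update p e 1) (avoidAll ends a₁ {a₂}) *
              prob (Function.update (Function.update p f 0) e 1) (avoidAll ends a₁ {a₂}) ^ 2 *
              (Gc (Function.update p e 0) ends o a₂ a₁ a₃ b *
                  prob (Function.update (Function.update p f 0) e 0) (PDEvent ends a₂ a₁ a₃) -
                (1 - p f) * Gc (Function.update (Function.update p f 0) e 0) ends o a₂ a₁ a₃ b *
                  prob (Function.update p e 0) (PDEvent ends a₂ a₁ a₃)) +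
            SClosure p ends o a₂ a₁ a₃ b e f) +
        p e ^ 2 *
          (prob (Function.update p e 0) (avoidAll ends a₁ {a₂}) * prob (Function.update p e 1) (avoidAll ends a₁ {a₂}) *
            prob (Function.update (Function.update p f 0) e 0) (avoidAll ends a₁ {a₂}) *
            prob (Function.update (Function.update p f 0) e 1) (avoidAll ends a₁ {a₂})) *
          (prob (Function.update p e 0) (PDEvent ends a₂ a₁ a₃) *
            prob (Function.update (Function.update p f 0) e 0) (PDEvent ends a₂ a₁ a₃)) *
          (g1C p ends o a₂ a₁ b e - (1 - p f) * g1C (Function.update p f 0) ends o a₂ a₁ b e)) := by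
    have hM' := hM.le
    refine mul_nonneg (sq_nonneg _) (add_nonneg (add_nonneg ?_ ?_) ?_)
    · exact mul_nonneg (mul_nonneg (sq_nonneg _) hM') hΔ₀
    · refine mul_nonneg (mul_nonneg ht0 h1t) (add_nonneg ?_ hS)
      exact mul_nonneg (mul_nonneg (mul_nonneg hQ0 hQ1) (sq_nonneg _)) hΔ₀
    · exact mul_nonneg (mul_nonneg (mul_nonneg (sq_nonneg _) hM') (mul_nonneg hD0 hD0f))
        (sub_nonneg.2 hg)
  rw [← hid] at hbr
  have hX := (mul_nonneg_iff_of_pos_left hM).1 hbr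
  linarith

end Mirror

end Mix

end Summit.Ventures.PercRepro2
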